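import Literature.MathematicalPhysics.QuantumLattice.IsotropicPropagatorSupBound
import Literature.MathematicalPhysics.QuantumLattice.HubbardFreeCovariance
import HarnessLib

/-!
# Single-scale sector propagators at positive temperature: the dimensional bound (BGM 2006, (2.49)–(2.50))

Topic `Literature/MathematicalPhysics/QuantumLattice`; the finite-`β` companion of
`SectorPropagatorSupBound.lean`. At inverse temperature `β` the time-momentum `k₀` runs over the
fermionic Matsubara frequencies `D_β = {π(2m+1)/β : m ∈ ℤ}` and BGM's sector propagator (2.49) is

  `g^{(h)}_ω(x₀, x⃗) = (1/β) Σ_{k₀ ∈ D_β} ∫ dk⃗/(2π)² e^{i(k⃗·x⃗ - k₀x₀)} F_{h,ω}(k) χ(k⃗)/(-ik₀ + ε(k⃗) - μ)`,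

for the scales `h_β ≤ h ≤ 0` above the temperature (`γ^{h_β} ≈ π/β`). PROVED here (our conventions:
no `(2π)^{-2}`, `γ = 4`, `h = -n`, central zone copy, `E_h ≡ ε`):

* `fermiMatsubara β m = π(2m+1)/β`, `|·| ≥ π/β`, and the **frequency count**
  `card {m : |π(2m+1)/β| ≤ a} ≤ aβ/π + 3` (`card_fermiMatsubara_le`);
* `thermalGenPropagator β e₀ μ n m ω x₀ x⃗` — the Matsubara sum of the two-index symbol `f_{-n}ζ_{m,ω}χ/D`
  (a `tsum` over `ℤ`, in fact a finite sum: `thermalGenPropagator_eq_sum`); `thermalSectorPropagator`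
  (`m = n`) and `thermalIsoPropagator` (`m = 2n`);
* `norm_sectorSliceIntegral_le` — each frequency slice is bounded by `sup × area`;
* **`norm_thermalGenPropagator_le`** — `‖g‖ ≤ 64 B₁(n,m)B₂(n,m) (1/π + 3·4ⁿ/(βe₀))`, hence, for the
  scales above the temperature (`4ⁿ ≤ β e₀`): `‖g^{(h)}_ω‖ ≤ 256 B₁(n)B₂(n) = O(γ^{(3/2)h})`
  (`norm_thermalSectorPropagator_le_of_scale`) and `‖ḡ^{(h)}_ω̄‖ ≤ 256 B̄₁(n)B̄₂(n) = O(γ^{2h})`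
  (`norm_thermalIsoPropagator_le_of_scale`) — the dimensional bounds (2.50)/(2.52), (2.60) at order
  zero, uniformly in `β`.

Everything is PROVED; the definitions are `fermiMatsubara`, `sectorSliceIntegral` and the propagators.

## Sources

* G. Benfatto, A. Giuliani, V. Mastropietro, Ann. Henri Poincaré 7 (2006) 809–898, §2.1 (the
  Matsubara frequencies `k₀ = 2π(n₀+½)/β`), §2.3 (`h_β`), §2.5 (2.49)–(2.50), (2.52)
  (arXiv:cond-mat/0507686 pp. 4, 6, 10–11). [BenfattoGiulianiMastropietro2006]
-/

noncomputable section

open Real Set MeasureTheory Complex Finset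
open scoped Topology

namespace Literature.MathematicalPhysics.QuantumLattice

/-! ### Fermionic Matsubara frequencies over `ℤ` -/

/-- The fermionic Matsubara frequency `π(2m+1)/β`, `m ∈ ℤ`. [cite: BenfattoGiulianiMastropietro2006, §2.1] -/
def fermiMatsubara (β : ℝ) (m : ℤ) : ℝ := π * (2 * (m : ℝ) + 1) / β

/-- `π/β ≤ |π(2m+1)/β|` (`0 < β`). [folklore] -/
theorem pi_div_le_abs_fermiMatsubara {β : ℝ} (hβ : 0 < β) (m : ℤ) : π / β ≤ |fermiMatsubara β m| := by
  rw [fermiMatsubara, abs_div, abs_mul, abs_of_pos Real.pi_pos, abs_of_pos hβ]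
  exact div_le_div_of_nonneg_right (le_mul_of_one_le_right Real.pi_pos.le (one_le_abs_two_mul_add_one _)) hβ.le

/-- If `|π(2m+1)/β| ≤ a` then `|m| ≤ aβ/(2π) + 1/2`, in particular `m ∈ [-K, K]` with `K = ⌈aβ/(2π)⌉₊`. [folklore] -/
theorem natAbs_le_of_abs_fermiMatsubara_le {β : ℝ} (hβ : 0 < β) {a : ℝ} {m : ℤ} (h : |fermiMatsubara β m| ≤ a) :
    m ∈ Finset.Icc (-(⌈a * β / (2 * π)⌉₊ : ℤ)) (⌈a * β / (2 * π)⌉₊ : ℤ) := by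
  rw [fermiMatsubara, abs_div, abs_mul, abs_of_pos Real.pi_pos, abs_of_pos hβ, div_le_iff₀ hβ] at h
  have h2 : |2 * (m : ℝ) + 1| ≤ a * β / π := by
    rw [le_div_iff₀ Real.pi_pos]; linarith [mul_comm π |2 * (m : ℝ) + 1|]
  have hm : |(m : ℝ)| ≤ a * β / (2 * π) + 1 / 2 := by
    have := abs_add_le (2 * (m : ℝ) + 1) (-1)
    rw [show 2 * (m : ℝ) + 1 + -1 = 2 * m by ring, abs_neg, abs_one, abs_mul, abs_two] at this
    have h3 : 2 * |(m : ℝ)| ≤ a * β / π + 1 := by linarith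
    have h4 : a * β / (2 * π) = (a * β / π) / 2 := by rw [div_div, mul_comm π 2]
    rw [h4]
    linarith
  have hK : a * β / (2 * π) ≤ (⌈a * β / (2 * π)⌉₊ : ℝ) := Nat.le_ceil _
  have hmK : |(m : ℝ)| < (⌈a * β / (2 * π)⌉₊ : ℝ) + 1 := by linarith
  rw [Finset.mem_Icc]
  have h4 : |m| ≤ (⌈a * β / (2 * π)⌉₊ : ℤ) := by
    have h5 : (((|m| : ℤ)) : ℝ) < ((⌈a * β / (2 * π)⌉₊ : ℕ) : ℝ) + 1 := by rw [Int.cast_abs]; exact hmK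
    have h6 : (|m| : ℤ) < ((⌈a * β / (2 * π)⌉₊ : ℕ) : ℤ) + 1 := by exact_mod_cast h5
    omega
  constructor <;> [have := neg_abs_le m; have := le_abs_self m] <;> omega

/-- **The frequency count**: the set `{m : |π(2m+1)/β| ≤ a}` is finite with at most
`2⌈aβ/(2π)⌉ + 1 ≤ aβ/π + 3` elements. [cite: BenfattoGiulianiMastropietro2006, §2.3] -/
theorem card_fermiMatsubara_le {β : ℝ} (hβ : 0 < β) {a : ℝ} (ha : 0 ≤ a) (S : Finset ℤ)
    (hS : ∀ m ∈ S, |fermiMatsubara β m| ≤ a) : (S.card : ℝ) ≤ a * β / π + 3 := by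
  set K : ℕ := ⌈a * β / (2 * π)⌉₊ with hK
  have hsub : S ⊆ Finset.Icc (-(K : ℤ)) K := fun m hm => natAbs_le_of_abs_fermiMatsubara_le hβ (hS m hm)
  have hcard := Finset.card_le_card hsub
  rw [Int.card_Icc] at hcard
  have h1 : ((K : ℤ) + 1 - -(K : ℤ)).toNat = 2 * K + 1 := by omega
  rw [h1] at hcard
  have hKle : (K : ℝ) < a * β / (2 * π) + 1 := Nat.ceil_lt_add_one (by positivity)
  have : (S.card : ℝ) ≤ 2 * K + 1 := by exact_mod_cast hcard
  calc (S.card : ℝ) ≤ 2 * K + 1 := this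
    _ ≤ 2 * (a * β / (2 * π) + 1) + 1 := by linarith
    _ = a * β / π + 3 := by field_simp; ring

/-! ### The Matsubara sum of the sector symbol -/

/-- The frequency slice `∫ dk⃗ e^{i(k⃗·x⃗ - k₀x₀)} f_{-n} ζ_{m,ω} χ/D` at `k₀` (two-index: scale `n`,
angular index `m`; `m = n` anisotropic, `m = 2n` isotropic). [cite: BenfattoGiulianiMastropietro2006, §2.5 (2.49), (2.59)] -/
def sectorSliceIntegral (e₀ μ : ℝ) (n m : ℕ) (ω : ℤ) (k₀ x₀ : ℝ) (x : Fin 2 → ℝ) : ℂ :=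
  ∫ k : Fin 2 → ℝ, Complex.exp (((k 0 * x 0 + k 1 * x 1 - k₀ * x₀ : ℝ) : ℂ) * Complex.I) * genSymbol e₀ μ n m ω (k₀, k)

/-- **The two-index single-scale sector propagator at inverse temperature `β`**:
`(1/β) Σ_{k₀ ∈ D_β} ∫ dk⃗ e^{i(k⃗·x⃗ - k₀x₀)} f_{-n} ζ_{m,ω} χ/(-ik₀ + ε - μ)` (`m = n`: BGM (2.49); `m = 2n`: (2.59)). [cite: BenfattoGiulianiMastropietro2006, §2.5 (2.49)] -/
def thermalGenPropagator (β e₀ μ : ℝ) (n m : ℕ) (ω : ℤ) (x₀ : ℝ) (x : Fin 2 → ℝ) : ℂ :=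
  ((1 / β : ℝ) : ℂ) * ∑' j : ℤ, sectorSliceIntegral e₀ μ n m ω (fermiMatsubara β j) x₀ x

/-- The anisotropic case `m = n`: `g^{(h)}_ω` at inverse temperature `β`. [cite: BenfattoGiulianiMastropietro2006, §2.5 (2.49)] -/
abbrev thermalSectorPropagator (β e₀ μ : ℝ) (n : ℕ) (ω : ℤ) (x₀ : ℝ) (x : Fin 2 → ℝ) : ℂ :=
  thermalGenPropagator β e₀ μ n n ω x₀ x

/-- The isotropic case `m = 2n`: `ḡ^{(h)}_ω̄` at inverse temperature `β`. [cite: BenfattoGiulianiMastropietro2006, §2.5 (2.59)] -/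
abbrev thermalIsoPropagator (β e₀ μ : ℝ) (n : ℕ) (ω : ℤ) (x₀ : ℝ) (x : Fin 2 → ℝ) : ℂ :=
  thermalGenPropagator β e₀ μ n (2 * n) ω x₀ x

section Bound

variable {μ : ℝ} (hμ₁ : -4 < μ) (hμ₂ : μ < -2 - Real.sqrt 2)
include hμ₁ hμ₂

/-- Off the scale support in `k₀` the slice vanishes: `|k₀| > e₀4^{-n} ⟹ slice = 0`. [cite: BenfattoGiulianiMastropietro2006, §2.3 (2.28)] -/
theorem sectorSliceIntegral_eq_zero {e₀ : ℝ} (he : 0 < e₀) (he' : e₀ ≤ (4 + μ) / 2) {n m : ℕ} {ω : ℤ} {k₀ : ℝ}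
    (hk : e₀ * (4 : ℝ) ^ (-(n : ℤ)) < |k₀|) (x₀ : ℝ) (x : Fin 2 → ℝ) : sectorSliceIntegral e₀ μ n m ω k₀ x₀ x = 0 := by
  rw [sectorSliceIntegral]
  refine integral_eq_zero_of_ae (ae_of_all _ fun k => ?_)
  have hS : genSymbol e₀ μ n m ω (k₀, k) = 0 := by
    by_contra hne
    have h1 := (genSymbol_ne_zero hμ₁ hμ₂ he he' hne).1
    simp only at h1
    have := abs_le.2 ⟨h1.1, h1.2⟩
    linarith
  simp [hS]

/-- **Each frequency slice is bounded by `sup × area`**: `‖slice‖ ≤ (e₀4^{-n-2})⁻¹ · 2B₁(n,m) · 2B₂(n,m)`. [cite: BenfattoGiulianiMastropietro2006, §2.5 (2.50)] -/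
theorem norm_sectorSliceIntegral_le {e₀ : ℝ} (he : 0 < e₀) (he' : e₀ ≤ (4 + μ) / 2) (n m : ℕ) (ω : ℤ) (k₀ x₀ : ℝ)
    (x : Fin 2 → ℝ) :
    ‖sectorSliceIntegral e₀ μ n m ω k₀ x₀ x‖ ≤
      (e₀ * (4 : ℝ) ^ (-(n : ℤ) - 2))⁻¹ * (2 * genNormalExtent μ e₀ n m * (2 * genTangentExtent μ e₀ n m)) := by
  set θ₀ : ℝ := ((ω : ℝ) + 1 / 2) * sectorWidth m with hθ₀
  set B₁ := genNormalExtent μ e₀ n m with hB₁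
  set B₂ := genTangentExtent μ e₀ n m with hB₂
  have hB₁0 : 0 ≤ B₁ := genNormalExtent_nonneg hμ₁ hμ₂ he n m
  have hB₂0 : 0 ≤ B₂ := genTangentExtent_nonneg hμ₁ he n m
  set M : ℝ := (e₀ * (4 : ℝ) ^ (-(n : ℤ) - 2))⁻¹ with hM
  have hM0 : 0 ≤ M := by rw [hM]; exact inv_nonneg.2 (mul_pos he (zpow_pos (by norm_num) _)).le
  set T : Set (Fin 2 → ℝ) := sectorBox μ θ₀ B₁ B₂ with hT
  set f : (Fin 2 → ℝ) → ℂ := fun k =>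
    Complex.exp (((k 0 * x 0 + k 1 * x 1 - k₀ * x₀ : ℝ) : ℂ) * Complex.I) * genSymbol e₀ μ n m ω (k₀, k) with hf
  have hfM : ∀ k, ‖f k‖ ≤ M := fun k => by
    rw [hf]
    simp only [norm_mul, Complex.norm_exp_ofReal_mul_I, one_mul]
    exact norm_genSymbol_le he n m ω (k₀, k)
  have hfT : ∀ k, k ∉ T → f k = 0 := by
    intro k hk
    by_contra hne
    have hS : genSymbol e₀ μ n m ω (k₀, k) ≠ 0 := right_ne_zero_of_mul hne
    exact hk (genSymbol_ne_zero hμ₁ hμ₂ he he' hS).2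
  have hvol : volume T ≤ ENNReal.ofReal (2 * B₁) * ENNReal.ofReal (2 * B₂) := volume_sectorBox_le hμ₁ hμ₂ θ₀ B₁ B₂
  have hvolT : volume T < ⊤ := lt_of_le_of_lt hvol (ENNReal.mul_lt_top ENNReal.ofReal_lt_top ENNReal.ofReal_lt_top)
  have hvolR : (volume T).toReal ≤ 2 * B₁ * (2 * B₂) := by
    have := ENNReal.toReal_mono (ENNReal.mul_ne_top ENNReal.ofReal_ne_top ENNReal.ofReal_ne_top) hvol
    rwa [ENNReal.toReal_mul, ENNReal.toReal_ofReal (by positivity), ENNReal.toReal_ofReal (by positivity)] at this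
  calc ‖sectorSliceIntegral e₀ μ n m ω k₀ x₀ x‖ = ‖∫ k, f k‖ := rfl
    _ = ‖∫ k in T, f k‖ := by rw [setIntegral_eq_integral_of_forall_compl_eq_zero hfT]
    _ ≤ M * (volume T).toReal := norm_setIntegral_le_of_norm_le_const hvolT fun k _ => hfM k
    _ ≤ M * (2 * B₁ * (2 * B₂)) := mul_le_mul_of_nonneg_left hvolR hM0

/-- The set of contributing frequencies is finite. [folklore] -/
theorem finite_support_slice {β e₀ : ℝ} (hβ : 0 < β) (he : 0 < e₀) (he' : e₀ ≤ (4 + μ) / 2) (n m : ℕ) (ω : ℤ)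
    (x₀ : ℝ) (x : Fin 2 → ℝ) :
    (Function.support fun j : ℤ => sectorSliceIntegral e₀ μ n m ω (fermiMatsubara β j) x₀ x) ⊆
      (Finset.Icc (-(⌈e₀ * (4 : ℝ) ^ (-(n : ℤ)) * β / (2 * π)⌉₊ : ℤ)) (⌈e₀ * (4 : ℝ) ^ (-(n : ℤ)) * β / (2 * π)⌉₊ : ℤ) : Set ℤ) := by
  intro j hj
  rw [Function.mem_support] at hj
  have hle : |fermiMatsubara β j| ≤ e₀ * (4 : ℝ) ^ (-(n : ℤ)) := by
    by_contra h; push Not at h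
    exact hj (sectorSliceIntegral_eq_zero hμ₁ hμ₂ he he' h x₀ x)
  exact natAbs_le_of_abs_fermiMatsubara_le hβ hle

/-- **The Matsubara sum is a finite sum** over the frequencies in the scale support. [cite: BenfattoGiulianiMastropietro2006, §2.5 (2.49)] -/
theorem thermalGenPropagator_eq_sum {β e₀ : ℝ} (hβ : 0 < β) (he : 0 < e₀) (he' : e₀ ≤ (4 + μ) / 2) (n m : ℕ) (ω : ℤ)
    (x₀ : ℝ) (x : Fin 2 → ℝ) :
    thermalGenPropagator β e₀ μ n m ω x₀ x = ((1 / β : ℝ) : ℂ) *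
      ∑ j ∈ Finset.Icc (-(⌈e₀ * (4 : ℝ) ^ (-(n : ℤ)) * β / (2 * π)⌉₊ : ℤ)) (⌈e₀ * (4 : ℝ) ^ (-(n : ℤ)) * β / (2 * π)⌉₊ : ℤ),
        sectorSliceIntegral e₀ μ n m ω (fermiMatsubara β j) x₀ x := by
  rw [thermalGenPropagator, tsum_eq_sum']
  exact finite_support_slice hμ₁ hμ₂ hβ he he' n m ω x₀ x

/-- **The dimensional bound at positive temperature**:
`‖g^{(h)}_ω(x)‖ ≤ 64 B₁(n) B₂(n) (1/π + 3·4ⁿ/(β e₀))` for all `β > 0`, `n, ω, x`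
(number of frequencies in the support `≤ e₀4^{-n}β/π + 3`, each slice `≤ sup × area`). [cite: BenfattoGiulianiMastropietro2006, §2.5 (2.50)] -/
theorem norm_thermalGenPropagator_le {β e₀ : ℝ} (hβ : 0 < β) (he : 0 < e₀) (he' : e₀ ≤ (4 + μ) / 2) (n m : ℕ) (ω : ℤ)
    (x₀ : ℝ) (x : Fin 2 → ℝ) :
    ‖thermalGenPropagator β e₀ μ n m ω x₀ x‖ ≤
      64 * (genNormalExtent μ e₀ n m * genTangentExtent μ e₀ n m) * (1 / π + 3 * (4 : ℝ) ^ n / (β * e₀)) := by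
  set a : ℝ := e₀ * (4 : ℝ) ^ (-(n : ℤ)) with ha
  have ha0 : 0 < a := mul_pos he (zpow_pos (by norm_num) _)
  set B₁ := genNormalExtent μ e₀ n m with hB₁
  set B₂ := genTangentExtent μ e₀ n m with hB₂
  have hB₁0 : 0 ≤ B₁ := genNormalExtent_nonneg hμ₁ hμ₂ he n m
  have hB₂0 : 0 ≤ B₂ := genTangentExtent_nonneg hμ₁ he n m
  set K : ℤ := (⌈a * β / (2 * π)⌉₊ : ℤ) with hK
  -- restrict the finite sum to the true support `S = {m : |k₀(m)| ≤ a}`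
  set S : Finset ℤ := (Finset.Icc (-K) K).filter fun j => |fermiMatsubara β j| ≤ a with hS
  have hsum : thermalGenPropagator β e₀ μ n m ω x₀ x =
      ((1 / β : ℝ) : ℂ) * ∑ j ∈ S, sectorSliceIntegral e₀ μ n m ω (fermiMatsubara β j) x₀ x := by
    rw [thermalGenPropagator_eq_sum hμ₁ hμ₂ hβ he he', hS, Finset.sum_filter]
    congr 1
    refine Finset.sum_congr rfl fun j _ => ?_
    split_ifs with h
    · rfl
    · push Not at h; exact sectorSliceIntegral_eq_zero hμ₁ hμ₂ he he' h x₀ x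
  have hcard : (S.card : ℝ) ≤ a * β / π + 3 :=
    card_fermiMatsubara_le hβ ha0.le S fun j hj => (Finset.mem_filter.1 hj).2
  set M : ℝ := (e₀ * (4 : ℝ) ^ (-(n : ℤ) - 2))⁻¹ with hM
  have hM0 : 0 ≤ M := by rw [hM]; exact inv_nonneg.2 (mul_pos he (zpow_pos (by norm_num) _)).le
  have hslice : ∀ j ∈ S, ‖sectorSliceIntegral e₀ μ n m ω (fermiMatsubara β j) x₀ x‖ ≤ M * (2 * B₁ * (2 * B₂)) := fun j _ =>
    norm_sectorSliceIntegral_le hμ₁ hμ₂ he he' n m ω _ x₀ x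
  rw [hsum, norm_mul, Complex.norm_real, Real.norm_eq_abs, abs_of_pos (by positivity)]
  calc 1 / β * ‖∑ j ∈ S, sectorSliceIntegral e₀ μ n m ω (fermiMatsubara β j) x₀ x‖
      ≤ 1 / β * ∑ j ∈ S, ‖sectorSliceIntegral e₀ μ n m ω (fermiMatsubara β j) x₀ x‖ :=
        mul_le_mul_of_nonneg_left (norm_sum_le _ _) (by positivity)
    _ ≤ 1 / β * (S.card * (M * (2 * B₁ * (2 * B₂)))) := by
        refine mul_le_mul_of_nonneg_left ?_ (by positivity)
        have := Finset.sum_le_card_nsmul S _ _ hslice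
        rwa [nsmul_eq_mul] at this
    _ ≤ 1 / β * ((a * β / π + 3) * (M * (2 * B₁ * (2 * B₂)))) := by
        refine mul_le_mul_of_nonneg_left (mul_le_mul_of_nonneg_right hcard (by positivity)) (by positivity)
    _ = 64 * (B₁ * B₂) * (1 / π + 3 * (4 : ℝ) ^ n / (β * e₀)) := by
        rw [hM, ha, zpow_sub₀ (by norm_num : (4 : ℝ) ≠ 0), zpow_neg, zpow_natCast]
        field_simp
        ring

/-- **Anisotropic sectors above the temperature (`4ⁿ ≤ β e₀`, i.e. `h ≥ h_β`):
`‖g^{(h)}_ω(x)‖ ≤ 256 B₁(n) B₂(n) = O(γ^{(3/2)h})` uniformly in `β`.** [cite: BenfattoGiulianiMastropietro2006, §2.5 (2.50), (2.52)] -/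
theorem norm_thermalSectorPropagator_le_of_scale {β e₀ : ℝ} (hβ : 0 < β) (he : 0 < e₀) (he' : e₀ ≤ (4 + μ) / 2) {n : ℕ}
    (hn : (4 : ℝ) ^ n ≤ β * e₀) (ω : ℤ) (x₀ : ℝ) (x : Fin 2 → ℝ) :
    ‖thermalSectorPropagator β e₀ μ n ω x₀ x‖ ≤ 256 * (normalExtent μ e₀ n * tangentExtent μ e₀ n) := by
  obtain ⟨hE1, hE2, -, -⟩ := genExtent_eq μ e₀ n
  have hB : 0 ≤ normalExtent μ e₀ n * tangentExtent μ e₀ n :=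
    mul_nonneg (normalExtent_nonneg hμ₁ hμ₂ he n) (tangentExtent_nonneg hμ₁ he n)
  have h1 : 3 * (4 : ℝ) ^ n / (β * e₀) ≤ 3 := by
    rw [div_le_iff₀ (by positivity)]; nlinarith
  have h2 : 1 / π ≤ 1 := by rw [div_le_one pi_pos]; linarith [Real.two_le_pi]
  have h := norm_thermalGenPropagator_le hμ₁ hμ₂ hβ he he' n n ω x₀ x
  rw [hE1, hE2] at h
  calc ‖thermalSectorPropagator β e₀ μ n ω x₀ x‖
      ≤ 64 * (normalExtent μ e₀ n * tangentExtent μ e₀ n) * (1 / π + 3 * (4 : ℝ) ^ n / (β * e₀)) := h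
    _ ≤ 64 * (normalExtent μ e₀ n * tangentExtent μ e₀ n) * 4 :=
        mul_le_mul_of_nonneg_left (by linarith) (by positivity)
    _ = 256 * (normalExtent μ e₀ n * tangentExtent μ e₀ n) := by ring

/-- **Isotropic sectors above the temperature: `‖ḡ^{(h)}_ω̄(x)‖ ≤ 256 B̄₁(n) B̄₂(n) = O(γ^{2h})`
uniformly in `β`.** [cite: BenfattoGiulianiMastropietro2006, §2.5 (2.60)] -/
theorem norm_thermalIsoPropagator_le_of_scale {β e₀ : ℝ} (hβ : 0 < β) (he : 0 < e₀) (he' : e₀ ≤ (4 + μ) / 2) {n : ℕ}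
    (hn : (4 : ℝ) ^ n ≤ β * e₀) (ω : ℤ) (x₀ : ℝ) (x : Fin 2 → ℝ) :
    ‖thermalIsoPropagator β e₀ μ n ω x₀ x‖ ≤ 256 * (isoNormalExtent μ e₀ n * isoTangentExtent μ e₀ n) := by
  obtain ⟨-, -, hE1, hE2⟩ := genExtent_eq μ e₀ n
  have hB : 0 ≤ isoNormalExtent μ e₀ n * isoTangentExtent μ e₀ n :=
    mul_nonneg (isoNormalExtent_nonneg hμ₁ hμ₂ he n) (isoTangentExtent_nonneg hμ₁ he n)
  have h1 : 3 * (4 : ℝ) ^ n / (β * e₀) ≤ 3 := by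
    rw [div_le_iff₀ (by positivity)]; nlinarith
  have h2 : 1 / π ≤ 1 := by rw [div_le_one pi_pos]; linarith [Real.two_le_pi]
  have h := norm_thermalGenPropagator_le hμ₁ hμ₂ hβ he he' n (2 * n) ω x₀ x
  rw [hE1, hE2] at h
  calc ‖thermalIsoPropagator β e₀ μ n ω x₀ x‖
      ≤ 64 * (isoNormalExtent μ e₀ n * isoTangentExtent μ e₀ n) * (1 / π + 3 * (4 : ℝ) ^ n / (β * e₀)) := h
    _ ≤ 64 * (isoNormalExtent μ e₀ n * isoTangentExtent μ e₀ n) * 4 :=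
        mul_le_mul_of_nonneg_left (by linarith) (by positivity)
    _ = 256 * (isoNormalExtent μ e₀ n * isoTangentExtent μ e₀ n) := by ring

end Bound

end Literature.MathematicalPhysics.QuantumLattice

end
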